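import Summits.NavierStokesRegularity.NavierStokesRegularity.Theses.WakeRatchet
import Summits.NavierStokesRegularity.NavierStokesRegularity.Theorems.WakeRatchetEternalViscousRateDissipativeRung

/-!
# LINE g10-3 — the CONVEYOR MASS is a conserved quantity (sorry-free bookkeeping)

For any shell field `W` with summable physical energy tails, final wakes `ω k = lim_σ E_k(σ)` and final
tails `L n = lim_σ T_n(σ)` (both supplied by hypothesis; they exist for bounded eternal solutions by the
PROVED stubs `stub_wakeLimit` / `stub_tailLimit`), the conveyor mass
  `m n := L n − Σ_k ω (n+k)`
satisfies `m n = m (n+1)` (`conveyorMass_succ`) and `0 ≤ m n` (`conveyorMass_nonneg`): it is ONE number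
`m ≥ 0` attached to the solution — the energy carried to `k = +∞` — and `stub_noConveyor` is the statement
`m = 0` on `E₂(R)` at small `ε₀`.  Model lattice only; nothing about NS.  No summit is proved by a line.
-/

set_option linter.dupNamespace false

open Filter Topology
open Literature.Analysis.FluidPDE.TaoCascade

namespace Summit.NavierStokesRegularity.NavierStokesRegularity.Cruxes.EternalInviscidRate.FinalWakeLedger

variable {m : ℕ}

/-- The conveyor mass above shell `n`: final tail minus the sum of the final wakes. -/
noncomputable def conveyorMass (ω L : ℤ → ℝ) (n : ℤ) : ℝ := L n - ∑' k : ℕ, ω (n + k)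

section
variable {ε₀ : ℝ} {W : ℤ → ℝ → Em m}
  (hS : ∀ (n : ℤ) (σ : ℝ), Summable (fun k : ℕ => physEnergy ε₀ W (n + k) σ))
  {ω : ℤ → ℝ} (hω : ∀ k : ℤ, Tendsto (physEnergy ε₀ W k) atTop (𝓝 (ω k)))
  {L : ℤ → ℝ} (hL : ∀ n : ℤ, Tendsto (fun σ => ∑' k : ℕ, physEnergy ε₀ W (n + k) σ) atTop (𝓝 (L n)))
include hS hω hL

/-- Final tails split off one final wake: `L n = ω n + L (n+1)`. -/
theorem finalTail_succ (n : ℤ) : L n = ω n + L (n + 1) := by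
  have h1 : Tendsto (fun σ => physEnergy ε₀ W n σ + ∑' k : ℕ, physEnergy ε₀ W (n + 1 + k) σ) atTop
      (𝓝 (ω n + L (n + 1))) := (hω n).add (hL (n + 1))
  have h2 : (fun σ => physEnergy ε₀ W n σ + ∑' k : ℕ, physEnergy ε₀ W (n + 1 + k) σ)
      = fun σ => ∑' k : ℕ, physEnergy ε₀ W (n + k) σ := by
    funext σ
    have h := (hS n σ).sum_add_tsum_nat_add 1
    have e : (fun k : ℕ => physEnergy ε₀ W (n + ((k + 1 : ℕ) : ℤ)) σ)
        = fun k : ℕ => physEnergy ε₀ W (n + 1 + k) σ := by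
      funext k; push_cast; ring_nf
    rw [e, Finset.sum_range_one] at h
    simpa using h
  rw [h2] at h1
  exact tendsto_nhds_unique (hL n) h1

omit hS hL in
/-- Final wakes are nonnegative. -/
theorem finalWake_nonneg (k : ℤ) : 0 ≤ ω k :=
  ge_of_tendsto' (hω k) fun _ => physEnergy_nonneg _ _ _ _

/-- Truncated sums of final wakes are bounded by the final tail. -/
theorem finalWake_sum_le (n : ℤ) (K : ℕ) : ∑ k ∈ Finset.range K, ω (n + k) ≤ L n := by
  have hlim : Tendsto (fun σ => ∑ k ∈ Finset.range K, physEnergy ε₀ W (n + k) σ) atTop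
      (𝓝 (∑ k ∈ Finset.range K, ω (n + k))) :=
    tendsto_finsetSum (Finset.range K) fun k _ => hω (n + (k : ℤ))
  refine le_of_tendsto_of_tendsto' hlim (hL n) fun σ => ?_
  exact (hS n σ).sum_le_tsum (Finset.range K) fun k _ => physEnergy_nonneg _ _ _ _

/-- The final wakes above any shell are summable. -/
theorem finalWake_summable (n : ℤ) : Summable (fun k : ℕ => ω (n + k)) :=
  summable_of_sum_range_le (fun _ => finalWake_nonneg hω _) (finalWake_sum_le hS hω hL n)

/-- **The conveyor mass is nonnegative.** -/
theorem conveyorMass_nonneg (n : ℤ) : 0 ≤ conveyorMass ω L n := by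
  unfold conveyorMass
  have := Real.tsum_le_of_sum_range_le (fun k => finalWake_nonneg hω (n + (k : ℤ)))
    (finalWake_sum_le hS hω hL n)
  linarith

/-- **The conveyor mass is conserved along the shell axis:** `m n = m (n+1)`. -/
theorem conveyorMass_succ (n : ℤ) : conveyorMass ω L n = conveyorMass ω L (n + 1) := by
  unfold conveyorMass
  have hT := finalTail_succ hS hω hL n
  have hw : ∑' k : ℕ, ω (n + k) = ω n + ∑' k : ℕ, ω (n + 1 + k) := by
    have h := (finalWake_summable hS hω hL n).sum_add_tsum_nat_add 1
    have e : (fun k : ℕ => ω (n + ((k + 1 : ℕ) : ℤ))) = fun k : ℕ => ω (n + 1 + k) := by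
      funext k; push_cast; ring_nf
    rw [e, Finset.sum_range_one] at h
    simpa using h.symm
  rw [hT, hw]; ring

/-- Hence `m n = m n'` for all shells `n ≤ n'` (and by symmetry for all pairs). -/
theorem conveyorMass_eq_of_le {n n' : ℤ} (h : n ≤ n') : conveyorMass ω L n = conveyorMass ω L n' := by
  obtain ⟨j, rfl⟩ := Int.le.dest h
  induction j with
  | zero => simp
  | succ j ih =>
    rw [ih (by omega), Nat.cast_succ, ← add_assoc]
    exact conveyorMass_succ hS hω hL _

/-- The conveyor mass does not depend on the base shell. -/
theorem conveyorMass_const (n n' : ℤ) : conveyorMass ω L n = conveyorMass ω L n' := by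
  rcases le_total n n' with h | h
  · exact conveyorMass_eq_of_le hS hω hL h
  · exact (conveyorMass_eq_of_le hS hω hL h).symm

/-- `stub_noConveyor`'s conclusion at shell `n` is `m n = 0`; by conservation it is shell-independent:
no conveyor above ONE shell ⇒ no conveyor above EVERY shell. -/
theorem noConveyor_all_of_one {n₀ : ℤ} (h0 : L n₀ = ∑' k : ℕ, ω (n₀ + k)) (n : ℤ) :
    L n = ∑' k : ℕ, ω (n + k) := by
  have h := conveyorMass_const hS hω hL n n₀
  unfold conveyorMass at h
  linarith

end


/-! ### `stub_noConveyor` is NECESSARY: the crux K1⁰ itself forces `m = 0`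

Iterating the crux's tail-ratio bound gives `L (n+j) ≤ (1+ε₀)^{-aj} · M → 0`, and the conveyor mass is
shell-independent and at most every final tail, hence `m = 0`.  So `EternalInviscidRate ⇒ NoConveyor R`
(the body of the skeleton's `NoConveyor` restated verbatim below, with the crux's own `εs(R)`):
`stub_noConveyor` is a genuine CONSEQUENCE of the crux — no effort on it is wasted. -/

-- `Λ > 1` for `ε₀ > 0`: the landed `EternalViscousRate.DissipationEdge.one_lt_bigLam` (p676906) is used by name (dedup lint).

/-- Geometric majorant of the energy tail below a log-time `b` (uniform bound `C`). -/
theorem physEnergy_tail_majorant {ε₀ : ℝ} (hε : 0 < ε₀) {W : ℤ → ℝ → Em m} {C : ℝ}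
    (hC : ∀ (k : ℤ) (σ : ℝ), ‖W k σ‖ ≤ C) (n : ℤ) {σ b : ℝ} (hσ : σ ≤ b) (k : ℕ) :
    physEnergy ε₀ W (n + k) σ
      ≤ (bigLam ε₀ ^ n)⁻¹ ^ 2 * (Real.exp (2 * b) * C ^ 2) * (((bigLam ε₀)⁻¹) ^ 2) ^ k := by
  have hΛ : 0 < bigLam ε₀ := bigLam_pos (by linarith)
  have hsplit : (bigLam ε₀ ^ (n + (k : ℤ)))⁻¹ ^ 2 = (bigLam ε₀ ^ n)⁻¹ ^ 2 * (((bigLam ε₀)⁻¹) ^ 2) ^ k := by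
    rw [zpow_add₀ hΛ.ne', zpow_natCast, mul_inv, mul_pow]
    congr 1
    rw [← inv_pow, ← pow_mul, ← pow_mul, mul_comm]
  have hWk : ‖W (n + k) σ‖ ^ 2 ≤ C ^ 2 := by
    have h0 : 0 ≤ ‖W (n + k) σ‖ := norm_nonneg _
    exact pow_le_pow_left₀ h0 (hC _ _) 2
  have hexp : Real.exp (2 * σ) ≤ Real.exp (2 * b) := Real.exp_le_exp.mpr (by linarith)
  have hA : 0 ≤ (bigLam ε₀ ^ (n + (k : ℤ)))⁻¹ ^ 2 := by positivity
  unfold physEnergy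
  calc (bigLam ε₀ ^ (n + (k : ℤ)))⁻¹ ^ 2 * (Real.exp (2 * σ) * ‖W (n + k) σ‖ ^ 2)
      ≤ (bigLam ε₀ ^ (n + (k : ℤ)))⁻¹ ^ 2 * (Real.exp (2 * b) * C ^ 2) :=
        mul_le_mul_of_nonneg_left (mul_le_mul hexp hWk (sq_nonneg _) (Real.exp_pos _).le) hA
    _ = (bigLam ε₀ ^ n)⁻¹ ^ 2 * (Real.exp (2 * b) * C ^ 2) * (((bigLam ε₀)⁻¹) ^ 2) ^ k := by
        rw [hsplit]; ring

/-- `Λ⁻² < 1` for `ε₀ > 0`. -/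
theorem bigLam_ratio_lt_one {ε₀ : ℝ} (hε : 0 < ε₀) : ((bigLam ε₀)⁻¹) ^ 2 < 1 := by
  have hΛ : 0 < bigLam ε₀ := bigLam_pos (by linarith)
  have h1 : (bigLam ε₀)⁻¹ < 1 := inv_lt_one_of_one_lt₀ (EternalViscousRate.DissipationEdge.one_lt_bigLam hε)
  have h2 : 0 ≤ (bigLam ε₀)⁻¹ := inv_nonneg.mpr hΛ.le
  calc ((bigLam ε₀)⁻¹) ^ 2 < 1 ^ 2 := pow_lt_pow_left₀ h1 h2 (by norm_num)
    _ = 1 := one_pow 2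

/-- Under `UniformBound`, every energy tail is summable. -/
theorem summable_physEnergy_tail_cm {ε₀ : ℝ} (hε : 0 < ε₀) {W : ℤ → ℝ → Em m} (hU : UniformBound W)
    (n : ℤ) (σ : ℝ) : Summable (fun k : ℕ => physEnergy ε₀ W (n + k) σ) := by
  obtain ⟨C, hC⟩ := hU
  have hr0 : 0 ≤ ((bigLam ε₀)⁻¹) ^ 2 := by positivity
  have hgeo := (summable_geometric_of_lt_one hr0 (bigLam_ratio_lt_one hε)).mul_left
    ((bigLam ε₀ ^ n)⁻¹ ^ 2 * (Real.exp (2 * σ) * C ^ 2))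
  exact Summable.of_nonneg_of_le (fun k => physEnergy_nonneg _ _ _ _)
    (fun k => physEnergy_tail_majorant hε hC n le_rfl k) hgeo

/-- Under `UniformBound`, a tail with a final value is GLOBALLY bounded in log-time. -/
theorem finalTail_globally_bdd {ε₀ : ℝ} (hε : 0 < ε₀) {W : ℤ → ℝ → Em m} (hU : UniformBound W)
    (n : ℤ) {L : ℝ} (hL : Tendsto (fun σ => ∑' k : ℕ, physEnergy ε₀ W (n + k) σ) atTop (𝓝 L)) :
    ∃ M : ℝ, ∀ σ : ℝ, ∑' k : ℕ, physEnergy ε₀ W (n + k) σ ≤ M := by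
  obtain ⟨C, hC⟩ := hU
  have hev : ∀ᶠ σ in atTop, ∑' k : ℕ, physEnergy ε₀ W (n + k) σ ≤ L + 1 :=
    (hL.eventually (Iic_mem_nhds (lt_add_one L))).mono fun σ h => h
  obtain ⟨σ₀, hσ₀⟩ := eventually_atTop.1 hev
  set G : ℝ := ∑' k : ℕ, (bigLam ε₀ ^ n)⁻¹ ^ 2 * (Real.exp (2 * σ₀) * C ^ 2) * (((bigLam ε₀)⁻¹) ^ 2) ^ k
  have hr0 : 0 ≤ ((bigLam ε₀)⁻¹) ^ 2 := by positivity
  have hgeo : Summable (fun k : ℕ => (bigLam ε₀ ^ n)⁻¹ ^ 2 * (Real.exp (2 * σ₀) * C ^ 2) * (((bigLam ε₀)⁻¹) ^ 2) ^ k) :=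
    (summable_geometric_of_lt_one hr0 (bigLam_ratio_lt_one hε)).mul_left _
  refine ⟨max (L + 1) G, fun σ => ?_⟩
  rcases le_total σ σ₀ with h | h
  · refine le_trans ?_ (le_max_right _ _)
    exact Summable.tsum_le_tsum (fun k => physEnergy_tail_majorant hε hC n h k)
      (summable_physEnergy_tail_cm hε ⟨C, hC⟩ n σ) hgeo
  · exact le_trans (hσ₀ σ h) (le_max_left _ _)

/-- **K1⁰ ⇒ no conveyor.**  The crux `EternalInviscidRate` implies the skeleton's `NoConveyor R`
(body verbatim) for every `R ≥ 1`, with the crux's own `εs(R)`. -/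
theorem noConveyor_of_eternalInviscidRate
    (hK : Summit.NavierStokesRegularity.NavierStokesRegularity.Theses.WakeRatchet.EternalInviscidRate) :
    ∀ R : ℝ, 1 ≤ R → ∃ εs : ℝ, 0 < εs ∧ ∀ ε₀ : ℝ, 0 < ε₀ → ε₀ ≤ εs →
    ∀ α : Fin 4 → Fin 4 → Fin 4 → ℤ × ℤ × ℤ → ℝ, InTableClass R α →
    ∀ W : ℤ → ℝ → Em 4, IsEternal ε₀ α W → UniformBound W →
    ∀ ω : ℤ → ℝ, (∀ k : ℤ, Tendsto (physEnergy ε₀ W k) atTop (𝓝 (ω k))) →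
    ∀ T : ℤ → ℝ, (∀ n : ℤ, Tendsto (fun σ => ∑' k : ℕ, physEnergy ε₀ W (n + k) σ) atTop (𝓝 (T n))) →
    ∀ n : ℤ, T n = ∑' k : ℕ, ω (n + k) := by
  intro R hR
  obtain ⟨a, ha, εs, hεs, hK'⟩ := hK R hR
  refine ⟨εs, hεs, ?_⟩
  intro ε₀ hε hεle α hα W hW hU ω hω T hT n
  have hS : ∀ (n : ℤ) (σ : ℝ), Summable (fun k : ℕ => physEnergy ε₀ W (n + k) σ) :=
    summable_physEnergy_tail_cm hε hU
  -- the ratio `q = (1+ε₀)^{-a} ∈ [0,1)`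
  set q : ℝ := (1 + ε₀) ^ (-a) with hq
  have hq0 : 0 ≤ q := Real.rpow_nonneg (by linarith) _
  have hq1 : q < 1 := Real.rpow_lt_one_of_one_lt_of_neg (by linarith) (by linarith)
  -- global bound of the tail above `n`, then iterate the crux
  obtain ⟨M, hM⟩ := finalTail_globally_bdd hε hU n (hT n)
  have hiter : ∀ j : ℕ, ∀ σ : ℝ, ∑' k : ℕ, physEnergy ε₀ W (n + j + k) σ ≤ q ^ j * M := by
    intro j
    induction j with
    | zero => intro σ; simpa using hM σ
    | succ j ih =>
      intro σ
      have h := hK' ε₀ hε hεle α hα W hW hU (n + j) (q ^ j * M) ih σ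
      have e : (fun k : ℕ => physEnergy ε₀ W (n + ((j + 1 : ℕ) : ℤ) + k) σ)
          = fun k : ℕ => physEnergy ε₀ W (n + j + 1 + k) σ := by
        funext k; push_cast; ring_nf
      rw [e, pow_succ]
      calc ∑' k : ℕ, physEnergy ε₀ W (n + j + 1 + k) σ ≤ (1 + ε₀) ^ (-a) * (q ^ j * M) := h
        _ = q ^ j * q * M := by rw [hq]; ring
  -- hence the final tails decay and the conveyor mass is ≤ q^j M for every j
  have hm_le : ∀ j : ℕ, conveyorMass ω T n ≤ q ^ j * M := by
    intro j
    have hLj : T (n + j) ≤ q ^ j * M := le_of_tendsto' (hT (n + j)) (hiter j)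
    have hconst := conveyorMass_const hS hω hT n (n + j)
    have hω0 : 0 ≤ ∑' k : ℕ, ω (n + j + k) := tsum_nonneg fun k => finalWake_nonneg hω _
    rw [hconst]; unfold conveyorMass; linarith
  have hlim : Tendsto (fun j : ℕ => q ^ j * M) atTop (𝓝 (0 * M)) :=
    (tendsto_pow_atTop_nhds_zero_of_lt_one hq0 hq1).mul_const M
  rw [zero_mul] at hlim
  have hm0 : conveyorMass ω T n ≤ 0 := ge_of_tendsto' hlim hm_le
  have hm1 : 0 ≤ conveyorMass ω T n := conveyorMass_nonneg hS hω hT n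
  have : conveyorMass ω T n = 0 := le_antisymm hm0 hm1
  unfold conveyorMass at this
  linarith


/-- **Refutation target for disprovers (contrapositive).**  A family of bounded eternal CONVEYORS
(`m ≠ 0`, i.e. some final tail differs from the sum of the final wakes above it) on tables of `E₂(R)`
at arbitrarily small `ε₀` refutes the crux K1⁰ itself. -/
theorem not_eternalInviscidRate_of_conveyors {R : ℝ} (hR : 1 ≤ R)
    (h : ∀ εs : ℝ, 0 < εs → ∃ ε₀ : ℝ, 0 < ε₀ ∧ ε₀ ≤ εs ∧
      ∃ α : Fin 4 → Fin 4 → Fin 4 → ℤ × ℤ × ℤ → ℝ, InTableClass R α ∧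
      ∃ W : ℤ → ℝ → Em 4, IsEternal ε₀ α W ∧ UniformBound W ∧
      ∃ ω : ℤ → ℝ, (∀ k : ℤ, Tendsto (physEnergy ε₀ W k) atTop (𝓝 (ω k))) ∧
      ∃ T : ℤ → ℝ, (∀ n : ℤ, Tendsto (fun σ => ∑' k : ℕ, physEnergy ε₀ W (n + k) σ) atTop (𝓝 (T n))) ∧
      ∃ n : ℤ, T n ≠ ∑' k : ℕ, ω (n + k)) :
    ¬ Summit.NavierStokesRegularity.NavierStokesRegularity.Theses.WakeRatchet.EternalInviscidRate := by
  intro hK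
  obtain ⟨εs, hεs, hN⟩ := noConveyor_of_eternalInviscidRate hK R hR
  obtain ⟨ε₀, hε, hεle, α, hα, W, hW, hU, ω, hω, T, hT, n, hn⟩ := h εs hεs
  exact hn (hN ε₀ hε hεle α hα W hW hU ω hω T hT n)

end Summit.NavierStokesRegularity.NavierStokesRegularity.Cruxes.EternalInviscidRate.FinalWakeLedger
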